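import Mathlib
import Literature.Analysis.Complex.HalfPlaneCauchyLine
import HarnessLib

/-!
# Route `WeakCouplingBCS` — channel-margin lane of `WcbcsKohnLuttingerB1g` (stmt-HubbardSuperconductivity-0158):
# zero-temperature frequency integrals of products of free fermion propagators

Helper file (everything here is PROVED; no definition, no named fact; nothing here asserts a pairing instability).
It supplies the residue calculus behind the `T = 0` reduction of the third-order particle–particle-irreducible
Cooper vertex (`Theorems/WeakCouplingBCSDefsKlThirdOrder.lean`: the closed-form case tables `jV`, `jOcc`, `jEmp`;
companion `Theorems/WeakCouplingBCSKlThirdOrderFrequencyIdentities.lean` proves they ARE the frequency integrals of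
the two-loop diagrams, cell file `run/shared/lean/pub/gate-hubbard-kl/U0-TABLE.md` v1 §1′ / v3.1 §3 (i)).

At temperature zero the fermionic Matsubara sum `β⁻¹ Σ_ω Π_j (iω - ξ_j)⁻¹` over a product of free propagators
with real one-particle energies `ξ_j ≠ 0` (measured from the Fermi level) becomes the frequency integral
`∫_ℝ dp₀/(2π) Π_j (i p₀ - ξ_j)⁻¹`, which is evaluated by closing the contour in a half-plane: the factor
`(i p₀ - ξ)⁻¹` has its only pole at `p₀ = -iξ`, in the LOWER half-plane for `ξ > 0` (empty state) and in the
UPPER half-plane for `ξ < 0` (occupied state).  From the tree's half-plane Cauchy theorems over the real line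
(`Literature.Analysis.Complex.integral_eq_zero_of_upperHalfPlane`, `…integral_div_sub_eq_of_upperHalfPlane`)
we derive, writing the propagator inline as `1 / (I * p - ξ)`:

* the pointwise estimates: `‖z‖ ≤ ‖i z - ξ‖` for `ξ > 0`, `Im z ≥ 0` (so `‖(iz - ξ)⁻¹‖ ≤ ‖z‖⁻¹` on the closed
  upper half-plane), differentiability there, `p ↦ -p` turns `ξ` into `-ξ`, and integrability over `ℝ` of
  products of two or three propagators;
* **pairs** (the particle–hole / particle–particle bubble frequency integral):
  `∫ dp₀ (i p₀ - ξ₁)⁻¹ (i p₀ - ξ₂)⁻¹ = 0` if `ξ₁, ξ₂` have the same sign, `= 2π/(ξ₂ - ξ₁)` if `ξ₁ > 0 > ξ₂`;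
  case-free form `integral_propagator_pair`: `= 2π · (-𝟙[ξ₁ξ₂ < 0]/(|ξ₁| + |ξ₂|))`
  (`= 2π (θ(-ξ₁) - θ(-ξ₂))/(ξ₁ - ξ₂)`, the `T = 0` Lindhard numerator);
* **triples**: `= 0` if all three energies have the same sign; `= 2π/((ξ₃-ξ₁)(ξ₃-ξ₂))` if `ξ₁, ξ₂ > 0 > ξ₃`;
  `= -2π/((ξ₃-ξ₁)(ξ₃-ξ₂))` if `ξ₁, ξ₂ < 0 < ξ₃` — every sign pattern of three nonzero energies up to the order
  of the factors (coincident energies of the same sign are allowed: only the lone pole on the other side must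
  be simple, and it is).

References: standard many-body perturbation theory (frequency integrals by residues); complex-analysis input =
Ahlfors, *Complex Analysis*, Ch. 4 §5.3, as formalised in `Literature/Analysis/Complex/HalfPlaneCauchyLine.lean`
(generic mathematics, kept next to its only consumer; statements are free of any Hubbard-model object and can be
re-homed under `Literature/` with a print locator).
-/

noncomputable section

-- the tree's namespace `Summit.<Summit>.<Problem>.Theorems` repeats the summit name by design (D-0017)
set_option linter.dupNamespace false

open MeasureTheory Complex Real

namespace Summit.HubbardSuperconductivity.HubbardSuperconductivity.Theorems.FreqIntegral

/-! ### Pointwise facts about the free propagator `1/(i z - ξ)` -/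

/-- For an empty-state energy `ξ > 0` and `Im z ≥ 0`: `‖z‖ ≤ ‖i z - ξ‖` (the pole `-iξ` lies in the open lower
half-plane). [folklore] -/
theorem norm_le_norm_I_mul_sub {ξ : ℝ} (hξ : 0 < ξ) {z : ℂ} (hz : 0 ≤ z.im) : ‖z‖ ≤ ‖I * z - ξ‖ := by
  have h1 : ‖z‖ ^ 2 ≤ ‖I * z - ξ‖ ^ 2 := by
    rw [Complex.sq_norm, Complex.sq_norm, Complex.normSq_apply, Complex.normSq_apply]
    have hre : (I * z - (ξ : ℂ)).re = -z.im - ξ := by simp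
    have him : (I * z - (ξ : ℂ)).im = z.re := by simp
    rw [hre, him]
    nlinarith
  exact (pow_le_pow_iff_left₀ (norm_nonneg _) (norm_nonneg _) two_ne_zero).1 h1

/-- For `ξ > 0` and `Im z ≥ 0` the propagator denominator does not vanish: `i z - ξ ≠ 0`. [folklore] -/
theorem propagatorDen_ne_zero {ξ : ℝ} (hξ : 0 < ξ) {z : ℂ} (hz : 0 ≤ z.im) : I * z - ξ ≠ 0 := by
  intro h
  have := congrArg Complex.re h
  simp at this
  linarith

/-- On the real axis the propagator denominator never vanishes: `i p - ξ ≠ 0` for `ξ ≠ 0`. [folklore] -/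
theorem propagatorDen_ofReal_ne_zero {ξ : ℝ} (hξ : ξ ≠ 0) (p : ℝ) : I * p - ξ ≠ 0 := by
  intro h
  have := congrArg Complex.re h
  simp at this
  exact hξ (by linarith)

/-- For `ξ > 0` the propagator `z ↦ 1/(iz - ξ)` is complex-differentiable at every point of the closed upper
half-plane. [folklore] -/
theorem differentiableAt_propagator {ξ : ℝ} (hξ : 0 < ξ) {z : ℂ} (hz : 0 ≤ z.im) :
    DifferentiableAt ℂ (fun z : ℂ => 1 / (I * z - ξ)) z :=
  (differentiableAt_const (1 : ℂ)).div
    (((differentiableAt_const I).mul differentiableAt_id).sub (differentiableAt_const _))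
    (propagatorDen_ne_zero hξ hz)

/-- For `ξ > 0`, `Im z ≥ 0`, `z ≠ 0`: `‖1/(iz - ξ)‖ ≤ 1/‖z‖`. [folklore] -/
theorem norm_propagator_le {ξ : ℝ} (hξ : 0 < ξ) {z : ℂ} (hz : 0 ≤ z.im) (hz0 : z ≠ 0) :
    ‖1 / (I * z - ξ)‖ ≤ 1 / ‖z‖ := by
  rw [norm_div, norm_one]
  exact one_div_le_one_div_of_le (norm_pos_iff.2 hz0) (norm_le_norm_I_mul_sub hξ hz)

/-- On the real axis: `‖1/(ip - ξ)‖ ≤ 1/|p|` for `p ≠ 0` (any real `ξ`). [folklore] -/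
theorem norm_propagator_ofReal_le {ξ : ℝ} {p : ℝ} (hp : p ≠ 0) : ‖1 / (I * p - ξ)‖ ≤ 1 / |p| := by
  rw [norm_div, norm_one]
  apply one_div_le_one_div_of_le (abs_pos.2 hp)
  have h1 : |p| ^ 2 ≤ ‖I * p - ξ‖ ^ 2 := by
    rw [Complex.sq_norm, Complex.normSq_apply, sq_abs]
    have hre : (I * p - (ξ : ℂ)).re = -ξ := by simp
    have him : (I * p - (ξ : ℂ)).im = p := by simp
    rw [hre, him]
    nlinarith
  exact (pow_le_pow_iff_left₀ (abs_nonneg _) (norm_nonneg _) two_ne_zero).1 h1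

/-- On the real axis: `‖1/(ip - ξ)‖ ≤ 1/|ξ|` for `ξ ≠ 0`. [folklore] -/
theorem norm_propagator_ofReal_le_inv {ξ : ℝ} (hξ : ξ ≠ 0) (p : ℝ) : ‖1 / (I * p - ξ)‖ ≤ 1 / |ξ| := by
  rw [norm_div, norm_one]
  apply one_div_le_one_div_of_le (abs_pos.2 hξ)
  have h1 : |ξ| ^ 2 ≤ ‖I * p - ξ‖ ^ 2 := by
    rw [Complex.sq_norm, Complex.normSq_apply, sq_abs]
    have hre : (I * p - (ξ : ℂ)).re = -ξ := by simp
    have him : (I * p - (ξ : ℂ)).im = p := by simp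
    rw [hre, him]
    nlinarith
  exact (pow_le_pow_iff_left₀ (abs_nonneg _) (norm_nonneg _) two_ne_zero).1 h1

/-- The real-axis propagator is continuous in the frequency (`ξ ≠ 0`). [folklore] -/
theorem continuous_propagator_ofReal {ξ : ℝ} (hξ : ξ ≠ 0) :
    Continuous (fun p : ℝ => 1 / (I * (p : ℂ) - ξ)) :=
  continuous_const.div (by fun_prop) (propagatorDen_ofReal_ne_zero hξ)

/-- Frequency reflection: `1/(i(-z) - ξ) = -1/(iz - (-ξ))` — the substitution `p₀ ↦ -p₀` exchanges occupied and
empty states. [folklore] -/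
theorem propagator_neg_arg (z : ℂ) (ξ : ℝ) :
    1 / (I * (-z) - (ξ : ℂ)) = -(1 / (I * z - ((-ξ : ℝ) : ℂ))) := by
  have : I * (-z) - (ξ : ℂ) = -(I * z - ((-ξ : ℝ) : ℂ)) := by push_cast; ring
  rw [this, one_div_neg_eq_neg_one_div]

/-! ### Integrability over the real line -/

/-- A product of two free propagators is integrable over the frequency axis (`ξ₁, ξ₂ ≠ 0`; decay `1/p₀²`).
[folklore] -/
theorem integrable_propagator_pair {a b : ℝ} (ha : a ≠ 0) (hb : b ≠ 0) :
    Integrable (fun p : ℝ => 1 / (I * (p : ℂ) - a) * (1 / (I * (p : ℂ) - b))) := by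
  refine Literature.Analysis.Complex.integrable_of_continuous_of_decay_sq (C := 1) (R := 1)
    ((continuous_propagator_ofReal ha).mul (continuous_propagator_ofReal hb)) fun p hp => ?_
  have hp0 : p ≠ 0 := by intro h; rw [h, abs_zero] at hp; linarith
  rw [norm_mul]
  calc ‖1 / (I * (p : ℂ) - a)‖ * ‖1 / (I * (p : ℂ) - b)‖ ≤ (1 / |p|) * (1 / |p|) :=
        mul_le_mul (norm_propagator_ofReal_le hp0) (norm_propagator_ofReal_le hp0) (norm_nonneg _)
          (by positivity)
    _ = 1 / p ^ 2 := by rw [← sq_abs]; ring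

/-- A product of three free propagators is integrable over the frequency axis (`ξ_j ≠ 0`). [folklore] -/
theorem integrable_propagator_triple {a b c : ℝ} (ha : a ≠ 0) (hb : b ≠ 0) (hc : c ≠ 0) :
    Integrable (fun p : ℝ => 1 / (I * (p : ℂ) - a) * (1 / (I * (p : ℂ) - b)) * (1 / (I * (p : ℂ) - c))) := by
  refine Literature.Analysis.Complex.integrable_of_continuous_of_decay_sq (C := 1 / |c|) (R := 1)
    (((continuous_propagator_ofReal ha).mul (continuous_propagator_ofReal hb)).mul
      (continuous_propagator_ofReal hc)) fun p hp => ?_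
  have hp0 : p ≠ 0 := by intro h; rw [h, abs_zero] at hp; linarith
  rw [norm_mul, norm_mul]
  calc ‖1 / (I * (p : ℂ) - a)‖ * ‖1 / (I * (p : ℂ) - b)‖ * ‖1 / (I * (p : ℂ) - c)‖
        ≤ (1 / |p|) * (1 / |p|) * (1 / |c|) :=
        mul_le_mul (mul_le_mul (norm_propagator_ofReal_le hp0) (norm_propagator_ofReal_le hp0)
          (norm_nonneg _) (by positivity)) (norm_propagator_ofReal_le_inv hc p) (norm_nonneg _)
          (by positivity)
    _ = (1 / |c|) / p ^ 2 := by rw [← sq_abs]; ring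

/-! ### Pairs: the bubble frequency integral -/

/-- Two empty-state propagators (`ξ₁, ξ₂ > 0`): `∫_ℝ dp₀ (ip₀ - ξ₁)⁻¹(ip₀ - ξ₂)⁻¹ = 0` (both poles in the lower
half-plane; close the contour in the upper one). [folklore] -/
theorem integral_propagator_pair_eq_zero_of_pos {a b : ℝ} (ha : 0 < a) (hb : 0 < b) :
    ∫ p : ℝ, 1 / (I * (p : ℂ) - a) * (1 / (I * (p : ℂ) - b)) = 0 := by
  refine Literature.Analysis.Complex.integral_eq_zero_of_upperHalfPlane
    (h := fun z : ℂ => 1 / (I * z - a) * (1 / (I * z - b))) (C := 1) (R₀ := 1) ?_ ?_ ?_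
  · intro z hz
    exact ((differentiableAt_propagator ha hz).mul
      (differentiableAt_propagator hb hz)).continuousAt.continuousWithinAt
  · intro z hz
    exact ((differentiableAt_propagator ha (le_of_lt hz)).mul
      (differentiableAt_propagator hb (le_of_lt hz))).differentiableWithinAt
  · intro z hz hR
    have hz0 : z ≠ 0 := by intro h0; rw [h0, norm_zero] at hR; linarith
    rw [norm_mul]
    calc ‖1 / (I * z - a)‖ * ‖1 / (I * z - b)‖ ≤ (1 / ‖z‖) * (1 / ‖z‖) :=
          mul_le_mul (norm_propagator_le ha hz hz0) (norm_propagator_le hb hz hz0) (norm_nonneg _)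
            (by positivity)
      _ = 1 / ‖z‖ ^ 2 := by ring

/-- One empty and one occupied state (`ξ₁ > 0 > ξ₂`):
`∫_ℝ dp₀ (ip₀ - ξ₁)⁻¹(ip₀ - ξ₂)⁻¹ = 2π/(ξ₂ - ξ₁)` (Cauchy's formula at the upper pole `-iξ₂`). [folklore] -/
theorem integral_propagator_pair_of_pos_of_neg {a b : ℝ} (ha : 0 < a) (hb : b < 0) :
    ∫ p : ℝ, 1 / (I * (p : ℂ) - a) * (1 / (I * (p : ℂ) - b)) = ((2 * π / (b - a) : ℝ) : ℂ) := by
  set w : ℂ := -(b : ℂ) * I with hw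
  have hwim : 0 < w.im := by simp [hw]; linarith
  have hIw : ∀ z : ℂ, I * (z - w) = I * z - b := by
    intro z
    calc I * (z - w) = I * z + (b : ℂ) * (I * I) := by rw [hw]; ring
      _ = I * z - b := by rw [Complex.I_mul_I]; ring
  have hpt : ∀ p : ℝ, 1 / (I * (p : ℂ) - a) * (1 / (I * (p : ℂ) - b)) =
      (-I * (1 / (I * (p : ℂ) - a))) / ((p : ℂ) - w) := by
    intro p
    rw [← hIw, one_div (I * _), mul_inv, Complex.inv_I]
    ring
  simp_rw [hpt]
  have key := Literature.Analysis.Complex.integral_div_sub_eq_of_upperHalfPlane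
    (h := fun z : ℂ => -I * (1 / (I * z - a))) (C := 1) (R₀ := 1) (w := w) ?_ ?_ ?_ hwim
  · rw [key]
    have hwa : I * w - (a : ℂ) = ((b - a : ℝ) : ℂ) := by
      have := hIw 0
      simp only [zero_sub, mul_neg, mul_zero] at this
      push_cast
      linear_combination -this
    simp only [hwa]
    have hba : ((b - a : ℝ) : ℂ) ≠ 0 := by
      exact_mod_cast (show b - a ≠ 0 by linarith)
    push_cast
    field_simp
    ring_nf
    rw [Complex.I_sq]
    ring
  · intro z hz
    exact ((differentiableAt_const _).mul
      (differentiableAt_propagator ha hz)).continuousAt.continuousWithinAt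
  · intro z hz
    exact ((differentiableAt_const _).mul
      (differentiableAt_propagator ha (le_of_lt hz))).differentiableWithinAt
  · intro z hz hR
    have hz0 : z ≠ 0 := by intro h0; rw [h0, norm_zero] at hR; linarith
    rw [norm_mul, norm_neg, Complex.norm_I, one_mul]
    exact norm_propagator_le ha hz hz0


/-- Two occupied-state propagators (`ξ₁, ξ₂ < 0`): the pair frequency integral vanishes (frequency reflection
`p₀ ↦ -p₀` reduces it to the empty-state case). [folklore] -/
theorem integral_propagator_pair_eq_zero_of_neg {a b : ℝ} (ha : a < 0) (hb : b < 0) :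
    ∫ p : ℝ, 1 / (I * (p : ℂ) - a) * (1 / (I * (p : ℂ) - b)) = 0 := by
  rw [← MeasureTheory.integral_neg_eq_self _ (volume : Measure ℝ)]
  have hpt : ∀ p : ℝ, 1 / (I * ((-p : ℝ) : ℂ) - a) * (1 / (I * ((-p : ℝ) : ℂ) - b)) =
      1 / (I * (p : ℂ) - ((-a : ℝ) : ℂ)) * (1 / (I * (p : ℂ) - ((-b : ℝ) : ℂ))) := by
    intro p
    rw [Complex.ofReal_neg, propagator_neg_arg, propagator_neg_arg]
    ring
  simp_rw [hpt]
  exact integral_propagator_pair_eq_zero_of_pos (neg_pos.2 ha) (neg_pos.2 hb)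

/-- One occupied and one empty state (`ξ₁ < 0 < ξ₂`): `∫_ℝ dp₀ (ip₀ - ξ₁)⁻¹(ip₀ - ξ₂)⁻¹ = 2π/(ξ₁ - ξ₂)`.
[folklore] -/
theorem integral_propagator_pair_of_neg_of_pos {a b : ℝ} (ha : a < 0) (hb : 0 < b) :
    ∫ p : ℝ, 1 / (I * (p : ℂ) - a) * (1 / (I * (p : ℂ) - b)) = ((2 * π / (a - b) : ℝ) : ℂ) := by
  have hcomm : ∀ p : ℝ, 1 / (I * (p : ℂ) - a) * (1 / (I * (p : ℂ) - b)) =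
      1 / (I * (p : ℂ) - b) * (1 / (I * (p : ℂ) - a)) := fun p => mul_comm _ _
  simp_rw [hcomm]
  exact integral_propagator_pair_of_pos_of_neg hb ha

/-- **The pair frequency integral, case-free** (`ξ₁, ξ₂ ≠ 0`):
`∫_ℝ dp₀ (ip₀ - ξ₁)⁻¹(ip₀ - ξ₂)⁻¹ = 2π · (-𝟙[ξ₁ξ₂ < 0] / (|ξ₁| + |ξ₂|))`, i.e. `2π (θ(-ξ₁) - θ(-ξ₂))/(ξ₁ - ξ₂)`:
the zero-temperature particle–hole (Lindhard) and particle–particle bubble frequency integral. [folklore] -/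
theorem integral_propagator_pair {a b : ℝ} (ha : a ≠ 0) (hb : b ≠ 0) :
    ∫ p : ℝ, 1 / (I * (p : ℂ) - a) * (1 / (I * (p : ℂ) - b)) =
      ((2 * π * (if a * b < 0 then -1 / (|a| + |b|) else 0) : ℝ) : ℂ) := by
  rcases lt_or_gt_of_ne ha with ha' | ha'
  · rcases lt_or_gt_of_ne hb with hb' | hb'
    · rw [integral_propagator_pair_eq_zero_of_neg ha' hb', if_neg (not_lt.2 (le_of_lt (mul_pos_of_neg_of_neg ha' hb')))]
      simp
    · rw [integral_propagator_pair_of_neg_of_pos ha' hb', if_pos (mul_neg_of_neg_of_pos ha' hb'),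
        abs_of_neg ha', abs_of_pos hb']
      push_cast
      have : ((a : ℂ) - b) ≠ 0 := by exact_mod_cast (show a - b ≠ 0 by linarith)
      have : (-(a : ℂ) + b) ≠ 0 := by exact_mod_cast (show -a + b ≠ 0 by linarith)
      field_simp
      ring
  · rcases lt_or_gt_of_ne hb with hb' | hb'
    · rw [integral_propagator_pair_of_pos_of_neg ha' hb', if_pos (mul_neg_of_pos_of_neg ha' hb'),
        abs_of_pos ha', abs_of_neg hb']
      push_cast
      have : ((b : ℂ) - a) ≠ 0 := by exact_mod_cast (show b - a ≠ 0 by linarith)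
      have : ((a : ℂ) + -b) ≠ 0 := by exact_mod_cast (show a + -b ≠ 0 by linarith)
      field_simp
      ring
    · rw [integral_propagator_pair_eq_zero_of_pos ha' hb', if_neg (not_lt.2 (le_of_lt (mul_pos ha' hb')))]
      simp

/-! ### Triples -/

/-- Three empty-state propagators (`ξ_j > 0`): the triple frequency integral vanishes. [folklore] -/
theorem integral_propagator_triple_eq_zero_of_pos {a b c : ℝ} (ha : 0 < a) (hb : 0 < b) (hc : 0 < c) :
    ∫ p : ℝ, 1 / (I * (p : ℂ) - a) * (1 / (I * (p : ℂ) - b)) * (1 / (I * (p : ℂ) - c)) = 0 := by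
  refine Literature.Analysis.Complex.integral_eq_zero_of_upperHalfPlane
    (h := fun z : ℂ => 1 / (I * z - a) * (1 / (I * z - b)) * (1 / (I * z - c))) (C := 1) (R₀ := 1) ?_ ?_ ?_
  · intro z hz
    exact (((differentiableAt_propagator ha hz).mul (differentiableAt_propagator hb hz)).mul
      (differentiableAt_propagator hc hz)).continuousAt.continuousWithinAt
  · intro z hz
    exact (((differentiableAt_propagator ha (le_of_lt hz)).mul
      (differentiableAt_propagator hb (le_of_lt hz))).mul
      (differentiableAt_propagator hc (le_of_lt hz))).differentiableWithinAt
  · intro z hz hR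
    have hz0 : z ≠ 0 := by intro h0; rw [h0, norm_zero] at hR; linarith
    have hzpos : 0 < ‖z‖ := norm_pos_iff.2 hz0
    have h3 : ‖1 / (I * z - c)‖ ≤ 1 := (norm_propagator_le hc hz hz0).trans (by
      rw [div_le_one hzpos]; exact hR)
    rw [norm_mul, norm_mul]
    calc ‖1 / (I * z - a)‖ * ‖1 / (I * z - b)‖ * ‖1 / (I * z - c)‖ ≤ (1 / ‖z‖) * (1 / ‖z‖) * 1 :=
          mul_le_mul (mul_le_mul (norm_propagator_le ha hz hz0) (norm_propagator_le hb hz hz0)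
            (norm_nonneg _) (by positivity)) h3 (norm_nonneg _) (by positivity)
      _ = 1 / ‖z‖ ^ 2 := by ring

/-- Two empty states and one occupied state (`ξ₁, ξ₂ > 0 > ξ₃`; `ξ₁ = ξ₂` allowed):
`∫_ℝ dp₀ (ip₀ - ξ₁)⁻¹(ip₀ - ξ₂)⁻¹(ip₀ - ξ₃)⁻¹ = 2π/((ξ₃ - ξ₁)(ξ₃ - ξ₂))` (Cauchy's formula at the upper pole
`-iξ₃`). [folklore] -/
theorem integral_propagator_triple_of_pos_pos_neg {a b c : ℝ} (ha : 0 < a) (hb : 0 < b) (hc : c < 0) :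
    ∫ p : ℝ, 1 / (I * (p : ℂ) - a) * (1 / (I * (p : ℂ) - b)) * (1 / (I * (p : ℂ) - c)) =
      ((2 * π / ((c - a) * (c - b)) : ℝ) : ℂ) := by
  set w : ℂ := -(c : ℂ) * I with hw
  have hwim : 0 < w.im := by simp [hw]; linarith
  have hIw : ∀ z : ℂ, I * (z - w) = I * z - c := by
    intro z
    calc I * (z - w) = I * z + (c : ℂ) * (I * I) := by rw [hw]; ring
      _ = I * z - c := by rw [Complex.I_mul_I]; ring
  have hpt : ∀ p : ℝ, 1 / (I * (p : ℂ) - a) * (1 / (I * (p : ℂ) - b)) * (1 / (I * (p : ℂ) - c)) =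
      (-I * (1 / (I * (p : ℂ) - a) * (1 / (I * (p : ℂ) - b)))) / ((p : ℂ) - w) := by
    intro p
    rw [← hIw, one_div (I * _), mul_inv, Complex.inv_I]
    ring
  simp_rw [hpt]
  have key := Literature.Analysis.Complex.integral_div_sub_eq_of_upperHalfPlane
    (h := fun z : ℂ => -I * (1 / (I * z - a) * (1 / (I * z - b)))) (C := 1) (R₀ := 1) (w := w) ?_ ?_ ?_ hwim
  · rw [key]
    have hIw0 : I * w = (c : ℂ) := by
      have := hIw 0
      simp only [zero_sub, mul_neg, mul_zero] at this
      linear_combination -this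
    have hwa : I * w - (a : ℂ) = ((c - a : ℝ) : ℂ) := by rw [hIw0]; push_cast; ring
    have hwb : I * w - (b : ℂ) = ((c - b : ℝ) : ℂ) := by rw [hIw0]; push_cast; ring
    simp only [hwa, hwb]
    have hca : ((c - a : ℝ) : ℂ) ≠ 0 := by exact_mod_cast (show c - a ≠ 0 by linarith)
    have hcb : ((c - b : ℝ) : ℂ) ≠ 0 := by exact_mod_cast (show c - b ≠ 0 by linarith)
    push_cast at hca hcb ⊢
    field_simp
    ring_nf
    rw [Complex.I_sq]
    ring
  · intro z hz
    exact ((differentiableAt_const _).mul ((differentiableAt_propagator ha hz).mul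
      (differentiableAt_propagator hb hz))).continuousAt.continuousWithinAt
  · intro z hz
    exact ((differentiableAt_const _).mul ((differentiableAt_propagator ha (le_of_lt hz)).mul
      (differentiableAt_propagator hb (le_of_lt hz)))).differentiableWithinAt
  · intro z hz hR
    have hz0 : z ≠ 0 := by intro h0; rw [h0, norm_zero] at hR; linarith
    have hzpos : 0 < ‖z‖ := norm_pos_iff.2 hz0
    have h2 : ‖1 / (I * z - b)‖ ≤ 1 := (norm_propagator_le hb hz hz0).trans (by
      rw [div_le_one hzpos]; exact hR)
    rw [norm_mul, norm_neg, Complex.norm_I, one_mul, norm_mul]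
    calc ‖1 / (I * z - a)‖ * ‖1 / (I * z - b)‖ ≤ (1 / ‖z‖) * 1 :=
          mul_le_mul (norm_propagator_le ha hz hz0) h2 (norm_nonneg _) (by positivity)
      _ = 1 / ‖z‖ := by ring

/-- Three occupied-state propagators (`ξ_j < 0`): the triple frequency integral vanishes. [folklore] -/
theorem integral_propagator_triple_eq_zero_of_neg {a b c : ℝ} (ha : a < 0) (hb : b < 0) (hc : c < 0) :
    ∫ p : ℝ, 1 / (I * (p : ℂ) - a) * (1 / (I * (p : ℂ) - b)) * (1 / (I * (p : ℂ) - c)) = 0 := by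
  rw [← MeasureTheory.integral_neg_eq_self _ (volume : Measure ℝ)]
  have hpt : ∀ p : ℝ, 1 / (I * ((-p : ℝ) : ℂ) - a) * (1 / (I * ((-p : ℝ) : ℂ) - b)) *
      (1 / (I * ((-p : ℝ) : ℂ) - c)) =
      -(1 / (I * (p : ℂ) - ((-a : ℝ) : ℂ)) * (1 / (I * (p : ℂ) - ((-b : ℝ) : ℂ))) *
        (1 / (I * (p : ℂ) - ((-c : ℝ) : ℂ)))) := by
    intro p
    rw [Complex.ofReal_neg, propagator_neg_arg, propagator_neg_arg, propagator_neg_arg]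
    ring
  simp_rw [hpt]
  rw [integral_neg, integral_propagator_triple_eq_zero_of_pos (neg_pos.2 ha) (neg_pos.2 hb) (neg_pos.2 hc),
    neg_zero]

/-- Two occupied states and one empty state (`ξ₁, ξ₂ < 0 < ξ₃`; `ξ₁ = ξ₂` allowed):
`∫_ℝ dp₀ (ip₀ - ξ₁)⁻¹(ip₀ - ξ₂)⁻¹(ip₀ - ξ₃)⁻¹ = -2π/((ξ₃ - ξ₁)(ξ₃ - ξ₂))` (by frequency reflection from the
previous case). [folklore] -/
theorem integral_propagator_triple_of_neg_neg_pos {a b c : ℝ} (ha : a < 0) (hb : b < 0) (hc : 0 < c) :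
    ∫ p : ℝ, 1 / (I * (p : ℂ) - a) * (1 / (I * (p : ℂ) - b)) * (1 / (I * (p : ℂ) - c)) =
      ((-(2 * π) / ((c - a) * (c - b)) : ℝ) : ℂ) := by
  rw [← MeasureTheory.integral_neg_eq_self _ (volume : Measure ℝ)]
  have hpt : ∀ p : ℝ, 1 / (I * ((-p : ℝ) : ℂ) - a) * (1 / (I * ((-p : ℝ) : ℂ) - b)) *
      (1 / (I * ((-p : ℝ) : ℂ) - c)) =
      -(1 / (I * (p : ℂ) - ((-a : ℝ) : ℂ)) * (1 / (I * (p : ℂ) - ((-b : ℝ) : ℂ))) *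
        (1 / (I * (p : ℂ) - ((-c : ℝ) : ℂ)))) := by
    intro p
    rw [Complex.ofReal_neg, propagator_neg_arg, propagator_neg_arg, propagator_neg_arg]
    ring
  simp_rw [hpt]
  rw [integral_neg, integral_propagator_triple_of_pos_pos_neg (neg_pos.2 ha) (neg_pos.2 hb) (neg_lt_zero.2 hc)]
  push_cast
  ring

end Summit.HubbardSuperconductivity.HubbardSuperconductivity.Theorems.FreqIntegral

end
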